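import Literature.Geometry.Symplectic.OrigamiSphereProofs
import Literature.Topology.FourManifolds.ImmersionCriterion

/-!
# Rung 0 at the round sphere: `S⁴` is a folded symplectic fold along a CHART 3-sphere

Helper file for item `FoldedSphereFoldExistence` (route SymplecticOrigami). The item asks, for
every homotopy 4-sphere `M`, for a folded symplectic form whose folding hypersurface is
`n ↦ e n` (`n ∈ S³ ⊂ ℝ⁴`) for a smooth embedding `e : ℝ⁴ → M`. Here we verify the conclusion
for `M = S⁴` itself (sanity / non-vacuity of the typed statement, and the model to be
transported along diffeomorphisms): `s = ω₀|_{S⁴}` is the origami form of Cannas da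
Silva–Guillemin–Pires 2010, Example 2.3 (tree: `sphereOrigamiForm`, folded along the equator
`equatorIncl`, PROVED in `OrigamiSphereProofs`), and `e` is the inverse stereographic projection
from the south pole `(0,0,0,0,-1)` onto the equatorial hyperplane,
`e(y) = (2y, 1 - ‖y‖²) / (1 + ‖y‖²)`, which restricts to the equator inclusion on the unit sphere
(`e(n) = (n, 0)` for `‖n‖ = 1`) and is a smooth embedding (its left inverse
`(x, h) ↦ x / (1 + h)` is smooth off the south pole).
-/

noncomputable section

-- the prescribed namespace `Summit.<P>.<Sub>.…` duplicates `SmoothPoincare4` (P = Sub)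
set_option linter.dupNamespace false

open scoped Manifold ContDiff Topology
open Set Function Metric
open Literature.Geometry.Symplectic Literature.Geometry.Kaehler

namespace Summit.SmoothPoincare4.SmoothPoincare4.Theorems.FoldedSphereFoldExistence

/-! ### Two generic lemmas: embeddings and immersions from a left inverse -/

section Generic

variable {𝕜 : Type*} [NontriviallyNormedField 𝕜]
  {EM : Type*} [NormedAddCommGroup EM] [NormedSpace 𝕜 EM] {HM : Type*} [TopologicalSpace HM]
  {I : ModelWithCorners 𝕜 EM HM} {X : Type*} [TopologicalSpace X] [ChartedSpace HM X]
  {EN : Type*} [NormedAddCommGroup EN] [NormedSpace 𝕜 EN] {HN : Type*} [TopologicalSpace HN]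
  {J : ModelWithCorners 𝕜 EN HN} {Y : Type*} [TopologicalSpace Y] [ChartedSpace HN Y]

/-- A map with a left inverse differentiable at the image point has injective differential
(chain rule: `dπ ∘ de = d(id) = id`). [folklore] -/
theorem mfderiv_injective_of_leftInverse {e : X → Y} {π : Y → X} {x : X} (hπe : π ∘ e = id)
    (he : MDifferentiableAt I J e x) (hπ : MDifferentiableAt J I π (e x)) :
    Injective (mfderiv I J e x) := by
  have hid : mfderiv I I (π ∘ e) x = ContinuousLinearMap.id 𝕜 (TangentSpace I x) := by
    rw [hπe]
    exact mfderiv_id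
  have hcomp := (mfderiv_comp x hπ he).symm.trans hid
  have key : ∀ u, mfderiv J I π (e x) (mfderiv I J e x u) = u := fun u =>
    congrArg (fun T : TangentSpace I x →L[𝕜] TangentSpace I x => T u) hcomp
  intro v w hvw
  have h := congrArg (mfderiv J I π (e x)) hvw
  rwa [key, key] at h

omit [ChartedSpace HM X] [ChartedSpace HN Y] in
/-- A continuous map with a left inverse that is continuous on an open set containing its range
is a topological embedding. [folklore] -/
theorem isEmbedding_of_leftInverse_continuousOn {e : X → Y} {π : Y → X} {U : Set Y}
    (hrange : ∀ x, e x ∈ U) (hπe : ∀ x, π (e x) = x) (he : Continuous e)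
    (hπ : ContinuousOn π U) : Topology.IsEmbedding e := by
  set e₀ : X → U := fun x => ⟨e x, hrange x⟩ with he₀
  have he₀c : Continuous e₀ := he.subtype_mk hrange
  have hπ₀c : Continuous (fun u : U => π u) := hπ.comp_continuous continuous_subtype_val
    fun u => u.2
  have hleft : LeftInverse (fun u : U => π u) e₀ := fun x => hπe x
  have h0 : Topology.IsEmbedding e₀ := hleft.isEmbedding hπ₀c he₀c
  exact Topology.IsEmbedding.subtypeVal.comp h0

end Generic

/-! ### The inverse stereographic projection from the south pole onto the equatorial plane -/

/-- The inverse stereographic projection `e(y) = (2y, 1 - ‖y‖²) / (1 + ‖y‖²)` lies on the unit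
sphere: `‖2y‖² + (1 - ‖y‖²)² = (1 + ‖y‖²)²`. [folklore] -/
theorem stereoInvSouth_mem_sphere (y : EuclideanSpace ℝ (Fin 4)) :
    (1 + ‖y‖ ^ 2)⁻¹ • ((2 : ℝ) • padFive y +
        (1 - ‖y‖ ^ 2) • EuclideanSpace.single (4 : Fin 5) (1 : ℝ)) ∈
      sphere (0 : EuclideanSpace ℝ (Fin 5)) 1 := by
  set r := ‖y‖ ^ 2 with hr
  have hr0 : 0 ≤ r := by positivity
  have hr1 : 1 + r ≠ 0 := by positivity
  have hy : y 0 ^ 2 + y 1 ^ 2 + y 2 ^ 2 + y 3 ^ 2 = r := by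
    rw [hr, EuclideanSpace.real_norm_sq_eq, Fin.sum_univ_four]
  rw [mem_sphere_zero_iff_norm]
  have h2 : ‖(1 + r)⁻¹ • ((2 : ℝ) • padFive y +
      (1 - r) • EuclideanSpace.single (4 : Fin 5) (1 : ℝ))‖ ^ 2 = 1 := by
    rw [EuclideanSpace.real_norm_sq_eq, Fin.sum_univ_five]
    simp
    field_simp
    nlinarith [hy]
  exact (pow_eq_one_iff_of_nonneg (norm_nonneg _) two_ne_zero).1 h2

/-- The inverse stereographic projection is `C^∞` as a map `ℝ⁴ → ℝ⁵`. [folklore] -/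
theorem contDiff_stereoInvSouth : ContDiff ℝ ∞ fun y : EuclideanSpace ℝ (Fin 4) =>
    (1 + ‖y‖ ^ 2)⁻¹ • ((2 : ℝ) • padFive y +
      (1 - ‖y‖ ^ 2) • EuclideanSpace.single (4 : Fin 5) (1 : ℝ)) := by
  have hn : ContDiff ℝ ∞ fun y : EuclideanSpace ℝ (Fin 4) => ‖y‖ ^ 2 := contDiff_norm_sq ℝ
  refine ContDiff.smul ((contDiff_const.add hn).inv fun y => by positivity) ?_
  exact ((padFive.toContinuousLinearMap.contDiff).const_smul (2 : ℝ)).add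
    ((contDiff_const.sub hn).smul contDiff_const)

/-- On the unit sphere the inverse stereographic projection is the equator inclusion:
`e(n) = (n, 0)` for `‖n‖ = 1`. [folklore] -/
theorem stereoInvSouth_unit (n : sphere (0 : EuclideanSpace ℝ (Fin 4)) 1) :
    (1 + ‖(n : EuclideanSpace ℝ (Fin 4))‖ ^ 2)⁻¹ • ((2 : ℝ) • padFive n +
        (1 - ‖(n : EuclideanSpace ℝ (Fin 4))‖ ^ 2) • EuclideanSpace.single (4 : Fin 5) (1 : ℝ)) =
      padFive n := by
  rw [norm_eq_of_mem_sphere n]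
  have h : (1 : ℝ) - 1 ^ 2 = 0 := by norm_num
  rw [h, zero_smul, add_zero, smul_smul]
  norm_num

/-- The left inverse `(x, h) ↦ x / (1 + h)` (stereographic projection from the south pole)
undoes `e`: `(1 + h(e y))⁻¹ · x(e y) = y`, where `1 + h(e y) = 2 / (1 + ‖y‖²)`. [folklore] -/
theorem stereoSouth_stereoInvSouth (y : EuclideanSpace ℝ (Fin 4)) :
    (1 + ((1 + ‖y‖ ^ 2)⁻¹ • ((2 : ℝ) • padFive y +
        (1 - ‖y‖ ^ 2) • EuclideanSpace.single (4 : Fin 5) (1 : ℝ))) 4)⁻¹ •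
      (WithLp.toLp 2 ![((1 + ‖y‖ ^ 2)⁻¹ • ((2 : ℝ) • padFive y +
          (1 - ‖y‖ ^ 2) • EuclideanSpace.single (4 : Fin 5) (1 : ℝ))) 0,
        ((1 + ‖y‖ ^ 2)⁻¹ • ((2 : ℝ) • padFive y +
          (1 - ‖y‖ ^ 2) • EuclideanSpace.single (4 : Fin 5) (1 : ℝ))) 1,
        ((1 + ‖y‖ ^ 2)⁻¹ • ((2 : ℝ) • padFive y +
          (1 - ‖y‖ ^ 2) • EuclideanSpace.single (4 : Fin 5) (1 : ℝ))) 2,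
        ((1 + ‖y‖ ^ 2)⁻¹ • ((2 : ℝ) • padFive y +
          (1 - ‖y‖ ^ 2) • EuclideanSpace.single (4 : Fin 5) (1 : ℝ))) 3] :
        EuclideanSpace ℝ (Fin 4)) = y := by
  set r := ‖y‖ ^ 2 with hr
  have hr1 : 1 + r ≠ 0 := by positivity
  have h4 : 1 + ((1 + r)⁻¹ • ((2 : ℝ) • padFive y +
      (1 - r) • EuclideanSpace.single (4 : Fin 5) (1 : ℝ))) 4 = 2 / (1 + r) := by
    simp
    field_simp
    ring
  rw [h4]
  ext i
  fin_cases i <;> simp <;> field_simp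

/-- **`S⁴` carries the data of rung 0 in the item's exact shape**: a folded symplectic form
(`ω₀|_{S⁴}`, Cannas da Silva–Guillemin–Pires 2010, Example 2.3) whose folding hypersurface is
`n ↦ e n`, `n ∈ S³ ⊂ ℝ⁴`, for the smooth embedding `e : ℝ⁴ → S⁴` given by the inverse
stereographic projection from the south pole (which is the equator inclusion on `S³`).
[cite: CannasdasilvaGuilleminPires2010, Example 2.3] -/
theorem exists_isFoldedForm_chartSphere_sphere :
    ∃ (s : MForm (𝓡 4) (sphere (0 : EuclideanSpace ℝ (Fin 5)) 1) ℝ 2)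
      (e : EuclideanSpace ℝ (Fin 4) → sphere (0 : EuclideanSpace ℝ (Fin 5)) 1),
      Manifold.IsSmoothEmbedding (𝓡 4) (𝓡 4) ∞ e ∧
        IsFoldedForm s (sphere (0 : EuclideanSpace ℝ (Fin 4)) 1) (fun n => e n) := by
  haveI : Fact (Module.finrank ℝ (EuclideanSpace ℝ (Fin 5)) = 4 + 1) :=
    ⟨finrank_euclideanSpace_fin⟩
  -- the maps
  set F : EuclideanSpace ℝ (Fin 4) → EuclideanSpace ℝ (Fin 5) := fun y =>
    (1 + ‖y‖ ^ 2)⁻¹ • ((2 : ℝ) • padFive y +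
      (1 - ‖y‖ ^ 2) • EuclideanSpace.single (4 : Fin 5) (1 : ℝ)) with hF
  set e : EuclideanSpace ℝ (Fin 4) → sphere (0 : EuclideanSpace ℝ (Fin 5)) 1 :=
    Set.codRestrict F _ stereoInvSouth_mem_sphere with he
  set G : EuclideanSpace ℝ (Fin 5) → EuclideanSpace ℝ (Fin 4) := fun z =>
    (1 + z 4)⁻¹ • (WithLp.toLp 2 ![z 0, z 1, z 2, z 3] : EuclideanSpace ℝ (Fin 4)) with hG
  set π : sphere (0 : EuclideanSpace ℝ (Fin 5)) 1 → EuclideanSpace ℝ (Fin 4) :=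
    fun x => G x with hπ
  -- `e` is smooth
  have hFs : ContDiff ℝ ∞ F := contDiff_stereoInvSouth
  have hes : ContMDiff 𝓘(ℝ, EuclideanSpace ℝ (Fin 4)) (𝓡 4) ∞ e :=
    hFs.contMDiff.codRestrict_sphere stereoInvSouth_mem_sphere
  -- `π ∘ e = id`
  have hπe : ∀ y, π (e y) = y := fun y => stereoSouth_stereoInvSouth y
  have hπe' : π ∘ e = id := funext hπe
  -- `G` is smooth off the hyperplane `1 + z₄ = 0`, which contains the range of `e`
  have hG_smooth : ∀ z : EuclideanSpace ℝ (Fin 5), 1 + z 4 ≠ 0 → ContDiffAt ℝ ∞ G z := by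
    intro z hz
    have h1 : ContDiffAt ℝ ∞ (fun z : EuclideanSpace ℝ (Fin 5) => (1 + z 4)⁻¹) z := by
      have h2 : ContDiff ℝ ∞ fun z : EuclideanSpace ℝ (Fin 5) => 1 + z 4 :=
        contDiff_const.add (contDiff_piLp_apply (p := 2) (i := (4 : Fin 5)))
      exact (contDiffAt_inv ℝ hz).comp z h2.contDiffAt
    have h3 : ContDiff ℝ ∞ fun z : EuclideanSpace ℝ (Fin 5) =>
        (WithLp.toLp 2 ![z 0, z 1, z 2, z 3] : EuclideanSpace ℝ (Fin 4)) := by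
      rw [contDiff_euclidean]
      intro i
      fin_cases i
      · simpa using contDiff_piLp_apply (𝕜 := ℝ) (n := ∞) (p := 2)
          (E := fun _ : Fin 5 => ℝ) (i := (0 : Fin 5))
      · simpa using contDiff_piLp_apply (𝕜 := ℝ) (n := ∞) (p := 2)
          (E := fun _ : Fin 5 => ℝ) (i := (1 : Fin 5))
      · simpa using contDiff_piLp_apply (𝕜 := ℝ) (n := ∞) (p := 2)
          (E := fun _ : Fin 5 => ℝ) (i := (2 : Fin 5))
      · simpa using contDiff_piLp_apply (𝕜 := ℝ) (n := ∞) (p := 2)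
          (E := fun _ : Fin 5 => ℝ) (i := (3 : Fin 5))
    exact h1.smul h3.contDiffAt
  have hrange : ∀ y, 1 + ((e y : sphere (0 : EuclideanSpace ℝ (Fin 5)) 1) :
      EuclideanSpace ℝ (Fin 5)) 4 ≠ 0 := by
    intro y
    have h : ((e y : sphere (0 : EuclideanSpace ℝ (Fin 5)) 1) : EuclideanSpace ℝ (Fin 5)) 4 =
        (1 + ‖y‖ ^ 2)⁻¹ * (1 - ‖y‖ ^ 2) := by
      simp [he, hF]
    rw [h]
    have hr : (0 : ℝ) ≤ ‖y‖ ^ 2 := by positivity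
    have h1 : (1 + ‖y‖ ^ 2)⁻¹ * (1 - ‖y‖ ^ 2) = (1 - ‖y‖ ^ 2) / (1 + ‖y‖ ^ 2) := by ring
    rw [h1]
    have h2 : 1 + (1 - ‖y‖ ^ 2) / (1 + ‖y‖ ^ 2) = 2 / (1 + ‖y‖ ^ 2) := by
      field_simp
      ring
    rw [h2]
    positivity
  have hπ_smooth : ∀ y, ContMDiffAt (𝓡 4) 𝓘(ℝ, EuclideanSpace ℝ (Fin 4)) ∞ π (e y) := fun y =>
    (hG_smooth _ (hrange y)).contMDiffAt.comp (e y)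
      (contMDiff_coe_sphere (E := EuclideanSpace ℝ (Fin 5)) (n := 4) (e y))
  -- `e` is a smooth embedding
  have hinj : ∀ y, Injective (mfderiv 𝓘(ℝ, EuclideanSpace ℝ (Fin 4)) (𝓡 4) e y) := fun y =>
    mfderiv_injective_of_leftInverse hπe' ((hes y).mdifferentiableAt (by simp))
      ((hπ_smooth y).mdifferentiableAt (by simp))
  have hemb : Topology.IsEmbedding e := by
    refine isEmbedding_of_leftInverse_continuousOn (U := {x | 1 + (x : EuclideanSpace ℝ (Fin 5)) 4 ≠ 0})
      hrange hπe hes.continuous ?_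
    refine continuousOn_of_forall_continuousAt fun x hx => ?_
    exact (hG_smooth _ hx).continuousAt.comp continuous_subtype_val.continuousAt
  have hsm : Manifold.IsSmoothEmbedding (𝓡 4) (𝓡 4) ∞ e :=
    ⟨Literature.Topology.FourManifolds.isImmersion_of_injective_mfderiv hes (by simp) hinj, hemb⟩
  -- on `S³`, `e` is the equator inclusion
  have heq : (fun n : sphere (0 : EuclideanSpace ℝ (Fin 4)) 1 => e n) = equatorIncl := by
    funext n
    apply Subtype.ext
    simp only [he, hF, val_codRestrict_apply, coe_equatorIncl]
    exact stereoInvSouth_unit n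
  refine ⟨sphereOrigamiForm, e, hsm, ?_⟩
  rw [heq]
  exact isFoldedForm_sphereOrigamiForm

end Summit.SmoothPoincare4.SmoothPoincare4.Theorems.FoldedSphereFoldExistence

end
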